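import Mathlib
import Literature.Analysis.Convex.MatrixStarAlgebraPSD
import HarnessLib

/-!
# Symmetry-adapted block diagonalisation of invariant semidefinite programs (Gatermann–Parrilo 2004, §4)

K. Gatermann, P. A. Parrilo, *Symmetry groups, semidefinite programs, and sums of squares*,
J. Pure Appl. Algebra 192 (2004) 95–128 (arXiv:math/0211450), **§4 "Induced actions and block
diagonalization", Theorem 4.1**: for a semidefinite program invariant under the action
`X ↦ ρ(g)ᵀ X ρ(g)` induced by an orthogonal representation `ρ` of a finite group, the feasible
set may be restricted to the fixed-point subspace `{X : ρ(g) X = X ρ(g) ∀ g}` (§3), and "there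
exists an explicitly computable coordinate transformation under which all invariant matrices are
block diagonal. As a consequence, the semidefinite program can be simplified to
`min Σᵢ nᵢ ⟨Cᵢ, Xᵢ⟩, X ∈ 𝓛, Xᵢ ∈ S^{mᵢ}_+`": with `ρ = m₁ϑ₁ ⊕ ⋯ ⊕ m_h ϑ_h` the canonical
decomposition and `T` the matrix of a symmetry-adapted basis, "by Schur's lemma `T⁻¹ X T` has
block diagonal form with one block `Xᵢ` for each irreducible representation of dimension `mᵢnᵢ`
which further decomposes into `nᵢ` equal blocks `Bᵢ` of dimension `mᵢ`" (Remark 4.2: "instead of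
a large SDP of dimension `Σᵢ nᵢ mᵢ`, we solve instead `h` coupled semidefinite programs of
dimension `mᵢ`").

This file formalises the COMPLEX form of the theorem (GP04 treat complex representations first,
"as the theory is considerably simpler in this case"; the real refinement by types of real
irreducibles is not formalised here). Notation: the irreducible `ϑᵢ` has degree `dᵢ = |d i|`
(GP04's `nᵢ`) and multiplicity `mᵢ = |m i|`; symmetry-adapted coordinates are indexed by
`BlockIndex d m = Σ i, d i × m i`.

PROVED here (no named facts used):

* §1 `IsIrrep`, `AreEquivalent`, `intertwiner_eq_zero`, `exists_eq_smul_one_of_comm` — Schur's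
  lemma for MATRIX representations `ϑ : G →* ℂ^{p×p}` of an arbitrary group, in both forms
  (Serre §2.2 Prop. 4 (1) and (2)), transported from Mathlib's `Representation.IsIrreducible`.
* §2 `eq_zero_of_kronecker_intertwiner`, `exists_eq_one_kronecker` — the Kronecker form: an
  intertwiner of `ϑ₁ ⊗ 1` and `ϑ₂ ⊗ 1` vanishes for non-equivalent irreducibles and is `1 ⊗ B`
  for `ϑ₁ = ϑ₂` irreducible.
* §3 `blockRep ϑ m : g ↦ ⊕ᵢ (ϑᵢ(g) ⊗ 1_{mᵢ})`, the unital `*`-homomorphism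
  `blockLift d m : (Bᵢ)ᵢ ↦ ⊕ᵢ (1_{dᵢ} ⊗ Bᵢ)`, and **`comm_blockRep_iff`** /
  `centralizer_range_blockRep_eq`: a matrix commutes with `⊕ᵢ (ϑᵢ ⊗ 1)` iff it is
  `⊕ᵢ (1 ⊗ Bᵢ)` — the block structure asserted by Theorem 4.1.
* §4 the data side of the reduced program: `trace_mul_blockLift` (`tr(A ⊕ᵢ(1⊗Bᵢ)) =
  Σᵢ tr(foldᵢ(A) Bᵢ)` for ANY `A`, through the partial trace `traceFold`),
  `trace_blockLift_mul_blockLift` (`= Σᵢ dᵢ tr(Cᵢ Bᵢ)`, GP04's `Σᵢ nᵢ ⟨Cᵢ, Xᵢ⟩`),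
  `posSemidef_blockLift_iff` (`⊕ᵢ(1⊗Bᵢ) ⪰ 0 ↔ ∀ i, Bᵢ ⪰ 0`), `isHermitian_blockLift_iff`.
* §5 `IsSymmetryAdapted ρ ϑ m T T'` (an invertible change of coordinates with
  `T⁻¹ ρ(g) T = ⊕ᵢ (ϑᵢ(g) ⊗ 1)`, `ϑᵢ` irreducible and pairwise non-equivalent) and, under it,
  **`IsSymmetryAdapted.comm_iff`** (`ρ(g)X = Xρ(g) ∀ g ↔ ∃ B, T⁻¹XT = ⊕ᵢ(1⊗Bᵢ)` — Theorem 4.1's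
  block diagonalisation), and for UNITARY `T` ("since `ρ` is assumed to be orthogonal the matrix
  `T` can also be chosen to be orthogonal"): `posSemidef_iff` (`X ⪰ 0 ↔ ∀ i, Bᵢ ⪰ 0`),
  `isHermitian_iff`, `trace_mul_eq`, `trace_mul_eq_sum_card` (objective and linear constraints
  of the reduced program).

NAMED FACT (stated, not proved): `UnitarySymmetryAdaptedBasisExists` — §6, the EXISTENCE of a
unitary symmetry-adapted basis for a unitary representation of a finite group (the first half of
Theorem 4.1; Serre §2.6 Thm 8 (canonical decomposition) and §2.7 Prop. 8 (explicit
decomposition), Fässler–Stiefel for the algorithm). Everything else in the file is independent of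
it, so a user assumes `(h : UnitarySymmetryAdaptedBasisExists G n)`, obtains `IsSymmetryAdapted`
data, and applies §5.

Relation to the tree (deliberately not duplicated): `Literature.Analysis.Convex.MatrixStarAlgebra`
(`MatrixStarAlgebraPSD.lean`) has positivity / trace facts for ABSTRACT block-diagonal
`*`-algebras and explicitly leaves out "the existence of the block-diagonalizing
`*`-isomorphism"; `InvariantSemidefinitePrograms.lean` is GP04 §3 (group averaging onto the
fixed-point subspace, Thm 3.3); `RegularStarRepresentation.lean` is the regular
`*`-representation of a matrix `*`-algebra (de Klerk–Pasechnik–Schrijver);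
`RepresentationTheory/FiniteGroups/IsotypicProjector.lean` and `UnitaryWedderburn.lean` are
Serre §2.6's projector formula and the Wedderburn blocks of `ℂ[G]`;
`LinearAlgebra/Matrix/StarSubalgebraMatrixUnits.lean` gives abstract matrix units. None states
the commutant structure `{X : Xρ = ρX} = T (⊕ᵢ 1⊗ℂ^{mᵢ×mᵢ}) T⁻¹` of Theorem 4.1, which is what
symmetry reduction of an SDP uses. We use `MatrixStarAlgebra.posSemidef_blockDiagonal'_iff`.

References: [GatermannParrilo2004] (held, arXiv:math/0211450; §4 pp. 9–10 read: Thm 4.1,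
Remark 4.2, Example 4.3); [Serre1977] J.-P. Serre, *Linear Representations of Finite Groups*,
GTM 42 (held; §1.1, §1.4, §2.2 Prop. 4, §2.6 Thm 8, §2.7 Prop. 8 read); A. Fässler, E. Stiefel,
*Group theoretical methods and their applications*, Birkhäuser 1992 (cited via GP04, not held).
-/

open scoped Matrix Kronecker ComplexOrder

namespace Literature.Analysis.Convex.SymmetryAdapted

variable {G : Type*} [Group G]

section Schur

variable {p q : Type*} [Fintype p] [DecidableEq p] [Fintype q] [DecidableEq q]

/-- The linear representation on `p → ℂ` attached to a matrix representation `ϑ : G →* ℂ^{p×p}`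
(`g ↦ (ϑ g).mulVec`). [folklore] -/
def toRep (ϑ : G →* Matrix p p ℂ) : Representation ℂ G (p → ℂ) where
  toFun g := Matrix.toLin' (ϑ g)
  map_one' := by rw [map_one, Matrix.toLin'_one]; rfl
  map_mul' a b := by rw [map_mul, Matrix.toLin'_mul]; rfl

/-- `toRep ϑ g` acts by `ϑ g`. [folklore] -/
@[simp] private theorem toRep_apply (ϑ : G →* Matrix p p ℂ) (g : G) (v : p → ℂ) :
    toRep ϑ g v = (ϑ g).mulVec v := by
  simp [toRep]

/-- A matrix representation is IRREDUCIBLE when the attached linear representation is: `p → ℂ`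
is non-zero and has no `G`-invariant subspace other than `0` and itself (Serre §1.4).
[cite: Serre1977, §1.4 Definition] -/
def IsIrrep (ϑ : G →* Matrix p p ℂ) : Prop := (toRep ϑ).IsIrreducible

/-- The bottom subrepresentation has underlying submodule `⊥`. [folklore] -/
private theorem toSubmodule_bot (ϑ : G →* Matrix p p ℂ) :
    (⊥ : Subrepresentation (toRep ϑ)).toSubmodule = ⊥ := rfl

/-- The top subrepresentation has underlying submodule `⊤`. [folklore] -/
private theorem toSubmodule_top (ϑ : G →* Matrix p p ℂ) :
    (⊤ : Subrepresentation (toRep ϑ)).toSubmodule = ⊤ := rfl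

/-- Irreducibility in matrix terms: `p` is non-empty and every subspace `W ≤ ℂ^p` invariant under
all `ϑ g` is `⊥` or `⊤`. [cite: Serre1977, §1.4 Definition] -/
theorem isIrrep_iff (ϑ : G →* Matrix p p ℂ) :
    IsIrrep ϑ ↔ Nonempty p ∧ ∀ W : Submodule ℂ (p → ℂ),
      (∀ g, ∀ v ∈ W, (ϑ g).mulVec v ∈ W) → W = ⊥ ∨ W = ⊤ := by
  classical
  constructor
  · intro h
    haveI hs : IsSimpleOrder (Subrepresentation (toRep ϑ)) := h
    refine ⟨?_, fun W hW => ?_⟩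
    · by_contra hp
      rw [not_nonempty_iff] at hp
      apply (bot_ne_top : (⊥ : Subrepresentation (toRep ϑ)) ≠ ⊤)
      apply Subrepresentation.toSubmodule_injective
      rw [toSubmodule_bot, toSubmodule_top]
      ext v
      simp [Subsingleton.elim v 0]
    · let W' : Subrepresentation (toRep ϑ) := ⟨W, fun g v hv => by simpa using hW g v hv⟩
      rcases hs.eq_bot_or_eq_top W' with h' | h'
      · left
        have := congrArg Subrepresentation.toSubmodule h'
        rw [toSubmodule_bot] at this
        exact this
      · right
        have := congrArg Subrepresentation.toSubmodule h'
        rw [toSubmodule_top] at this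
        exact this
  · rintro ⟨hp, h⟩
    refine { exists_pair_ne := ?_, eq_bot_or_eq_top := fun W => ?_ }
    · refine ⟨⊥, ⊤, fun hbt => ?_⟩
      have := congrArg Subrepresentation.toSubmodule hbt
      rw [toSubmodule_bot, toSubmodule_top] at this
      exact bot_ne_top this
    · rcases h W.toSubmodule (fun g v hv => by simpa using W.apply_mem_toSubmodule g hv) with
        h' | h'
      · left
        exact Subrepresentation.toSubmodule_injective (h'.trans (toSubmodule_bot ϑ).symm)
      · right
        exact Subrepresentation.toSubmodule_injective (h'.trans (toSubmodule_top ϑ).symm)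

/-- Two matrix representations are EQUIVALENT when they are intertwined by an invertible matrix:
`P ϑ₁(g) = ϑ₂(g) P` for all `g`, `P` invertible (Serre §1.1: "similar (or isomorphic)").
[cite: Serre1977, §1.1 Definition] -/
def AreEquivalent (ϑ₁ : G →* Matrix p p ℂ) (ϑ₂ : G →* Matrix q q ℂ) : Prop :=
  ∃ P : Matrix q p ℂ, ∃ Q : Matrix p q ℂ, P * Q = 1 ∧ Q * P = 1 ∧ ∀ g, P * ϑ₁ g = ϑ₂ g * P

/-- A matrix intertwiner `M ϑ₁(g) = ϑ₂(g) M` is an intertwining map of the attached linear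
representations. [folklore] -/
def intertwiner (ϑ₁ : G →* Matrix p p ℂ) (ϑ₂ : G →* Matrix q q ℂ) (M : Matrix q p ℂ)
    (hM : ∀ g, M * ϑ₁ g = ϑ₂ g * M) : (toRep ϑ₁).IntertwiningMap (toRep ϑ₂) :=
  (Matrix.toLin' M).intertwiningMap_of_isIntertwiningMap (toRep ϑ₁) (toRep ϑ₂) fun g v => by
    simp only [toRep_apply, Matrix.toLin'_apply, Matrix.mulVec_mulVec, hM g]

/-- The intertwining map attached to `M` acts by `M`. [folklore] -/
@[simp] private theorem intertwiner_apply (ϑ₁ : G →* Matrix p p ℂ) (ϑ₂ : G →* Matrix q q ℂ)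
    (M : Matrix q p ℂ) (hM : ∀ g, M * ϑ₁ g = ϑ₂ g * M) (v : p → ℂ) :
    intertwiner ϑ₁ ϑ₂ M hM v = M.mulVec v := rfl

/-- **Schur's lemma, part 1** (Serre §2.2 Prop. 4(1)): an intertwiner between two IRREDUCIBLE,
NON-EQUIVALENT matrix representations is zero. [cite: Serre1977, §2.2 Prop. 4 (1)] -/
theorem intertwiner_eq_zero {ϑ₁ : G →* Matrix p p ℂ} {ϑ₂ : G →* Matrix q q ℂ}
    (h₁ : IsIrrep ϑ₁) (h₂ : IsIrrep ϑ₂) (hne : ¬ AreEquivalent ϑ₁ ϑ₂) {M : Matrix q p ℂ}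
    (hM : ∀ g, M * ϑ₁ g = ϑ₂ g * M) : M = 0 := by
  haveI : (toRep ϑ₁).IsIrreducible := h₁
  haveI : (toRep ϑ₂).IsIrreducible := h₂
  rcases Representation.IsIrreducible.bijective_or_eq_zero (intertwiner ϑ₁ ϑ₂ M hM) with hb | hz
  · exfalso
    apply hne
    have hb' : Function.Bijective (Matrix.toLin' M) := by
      have : ⇑(intertwiner ϑ₁ ϑ₂ M hM) = ⇑(Matrix.toLin' M) := by
        funext v; rfl
      rwa [this] at hb
    let e : (p → ℂ) ≃ₗ[ℂ] (q → ℂ) := LinearEquiv.ofBijective (Matrix.toLin' M) hb'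
    have he : ∀ v, e v = Matrix.toLin' M v := fun v => rfl
    refine ⟨M, LinearMap.toMatrix' (e.symm : (q → ℂ) →ₗ[ℂ] (p → ℂ)), ?_, ?_, hM⟩
    · have h1 : Matrix.toLin' (M * LinearMap.toMatrix' (e.symm : (q → ℂ) →ₗ[ℂ] (p → ℂ))) =
          Matrix.toLin' (1 : Matrix q q ℂ) := by
        rw [Matrix.toLin'_mul, Matrix.toLin'_toMatrix', Matrix.toLin'_one]
        refine LinearMap.ext fun v => ?_
        simp only [LinearMap.coe_comp, Function.comp_apply, LinearEquiv.coe_coe, LinearMap.id_coe,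
          id_eq, ← he]
        exact e.apply_symm_apply v
      exact Matrix.toLin'.injective h1
    · have h1 : Matrix.toLin' (LinearMap.toMatrix' (e.symm : (q → ℂ) →ₗ[ℂ] (p → ℂ)) * M) =
          Matrix.toLin' (1 : Matrix p p ℂ) := by
        rw [Matrix.toLin'_mul, Matrix.toLin'_toMatrix', Matrix.toLin'_one]
        refine LinearMap.ext fun v => ?_
        simp only [LinearMap.coe_comp, Function.comp_apply, LinearEquiv.coe_coe, LinearMap.id_coe,
          id_eq, ← he]
        exact e.symm_apply_apply v
      exact Matrix.toLin'.injective h1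
  · have h1 : Matrix.toLin' M = 0 := by
      refine LinearMap.ext fun v => ?_
      have := congrArg (fun f : (toRep ϑ₁).IntertwiningMap (toRep ϑ₂) => f v) hz
      simpa using this
    simpa using h1

/-- **Schur's lemma, part 2** (Serre §2.2 Prop. 4(2)): a matrix commuting with an IRREDUCIBLE
complex matrix representation is a scalar (`ℂ` is algebraically closed).
[cite: Serre1977, §2.2 Prop. 4 (2)] -/
theorem exists_eq_smul_one_of_comm {ϑ : G →* Matrix p p ℂ} (h : IsIrrep ϑ) {M : Matrix p p ℂ}
    (hM : ∀ g, M * ϑ g = ϑ g * M) : ∃ c : ℂ, M = c • (1 : Matrix p p ℂ) := by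
  haveI : (toRep ϑ).IsIrreducible := h
  obtain ⟨c, hc⟩ :=
    (Representation.IsIrreducible.algebraMap_intertwiningMap_bijective_of_isAlgClosed
      (ρ := toRep ϑ)).2 (intertwiner ϑ ϑ M hM)
  refine ⟨c, ?_⟩
  have h1 : Matrix.toLin' M = Matrix.toLin' (c • (1 : Matrix p p ℂ)) := by
    refine LinearMap.ext fun v => ?_
    have := congrArg (fun f : (toRep ϑ).IntertwiningMap (toRep ϑ) => f v) hc
    simp only [Representation.IntertwiningMap.algebraMap_apply,
      Representation.IntertwiningMap.smul_apply,
      Representation.IntertwiningMap.coe_one, id_eq, intertwiner_apply] at this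
    simp [Matrix.toLin'_apply, ← this]
  exact Matrix.toLin'.injective h1

end Schur

/-! ## 2. Intertwiners of `ϑ ⊗ 1`: the Kronecker form of Schur's lemma -/

section KroneckerSchur

variable {p q m₁ m₂ : Type*}

/-- The `(a, b)` multiplicity slice of a matrix indexed by `(irrep coordinate) × (copy)`.
[folklore] -/
def slice (Y : Matrix (q × m₂) (p × m₁) ℂ) (a : m₂) (b : m₁) : Matrix q p ℂ :=
  fun s t => Y (s, a) (t, b)

/-- Entries of a slice. [folklore] -/
@[simp] private theorem slice_apply (Y : Matrix (q × m₂) (p × m₁) ℂ) (a : m₂) (b : m₁) (s : q) (t : p) :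
    slice Y a b s t = Y (s, a) (t, b) := rfl

/-- `1_p ⊗ B = 1_p ⊗ C` forces `B = C` once `p` is non-empty. [folklore] -/
private theorem one_kronecker_injective [DecidableEq p] [Nonempty p] :
    Function.Injective fun B : Matrix m₂ m₁ ℂ => (1 : Matrix p p ℂ) ⊗ₖ B := by
  intro B C h
  obtain ⟨s⟩ := ‹Nonempty p›
  ext a b
  have := congrFun (congrFun h (s, a)) (s, b)
  simpa [Matrix.kroneckerMap_apply] using this

/-- Slicing commutes with right multiplication by `A ⊗ 1`. [folklore] -/
private theorem slice_mul_eq [Fintype p] [Fintype m₁] [DecidableEq m₁] (Y : Matrix (q × m₂) (p × m₁) ℂ)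
    (A : Matrix p p ℂ) (a : m₂) (b : m₁) :
    slice Y a b * A = slice (Y * (A ⊗ₖ (1 : Matrix m₁ m₁ ℂ))) a b := by
  ext s t
  simp only [Matrix.mul_apply, slice_apply, Fintype.sum_prod_type, Matrix.kroneckerMap_apply,
    Matrix.one_apply, mul_ite, mul_one, mul_zero]
  refine Finset.sum_congr rfl fun t' _ => ?_
  rw [Finset.sum_ite_eq' Finset.univ b]
  simp

/-- Slicing commutes with left multiplication by `A ⊗ 1`. [folklore] -/
private theorem mul_slice_eq [Fintype q] [Fintype m₂] [DecidableEq m₂] (Y : Matrix (q × m₂) (p × m₁) ℂ)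
    (A : Matrix q q ℂ) (a : m₂) (b : m₁) :
    A * slice Y a b = slice ((A ⊗ₖ (1 : Matrix m₂ m₂ ℂ)) * Y) a b := by
  ext s t
  simp only [Matrix.mul_apply, slice_apply, Fintype.sum_prod_type, Matrix.kroneckerMap_apply,
    Matrix.one_apply, mul_ite, mul_one, mul_zero, ite_mul, zero_mul]
  refine Finset.sum_congr rfl fun s' _ => ?_
  rw [Finset.sum_ite_eq Finset.univ a]
  simp

variable [Fintype p] [DecidableEq p] [Fintype q] [DecidableEq q]
variable [Fintype m₁] [DecidableEq m₁] [Fintype m₂] [DecidableEq m₂]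

/-- Slices of an intertwiner of `ϑ₁ ⊗ 1` and `ϑ₂ ⊗ 1` intertwine `ϑ₁` and `ϑ₂`. [folklore] -/
private theorem slice_intertwines {ϑ₁ : G →* Matrix p p ℂ} {ϑ₂ : G →* Matrix q q ℂ}
    {Y : Matrix (q × m₂) (p × m₁) ℂ}
    (hY : ∀ g, Y * (ϑ₁ g ⊗ₖ (1 : Matrix m₁ m₁ ℂ)) = (ϑ₂ g ⊗ₖ (1 : Matrix m₂ m₂ ℂ)) * Y)
    (a : m₂) (b : m₁) (g : G) : slice Y a b * ϑ₁ g = ϑ₂ g * slice Y a b := by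
  rw [slice_mul_eq, mul_slice_eq, hY g]

/-- **Schur, Kronecker form (1)**: an intertwiner of `ϑ₁ ⊗ 1_{m₁}` and `ϑ₂ ⊗ 1_{m₂}` for
irreducible NON-EQUIVALENT `ϑ₁, ϑ₂` vanishes — the off-diagonal blocks of GP04's `T⁻¹ X T` are
zero. [cite: GatermannParrilo2004, §4 (block form of `T⁻¹XT` via Schur's lemma); Serre1977, §2.2 Prop. 4] -/
theorem eq_zero_of_kronecker_intertwiner {ϑ₁ : G →* Matrix p p ℂ} {ϑ₂ : G →* Matrix q q ℂ}
    (h₁ : IsIrrep ϑ₁) (h₂ : IsIrrep ϑ₂) (hne : ¬ AreEquivalent ϑ₁ ϑ₂)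
    {Y : Matrix (q × m₂) (p × m₁) ℂ}
    (hY : ∀ g, Y * (ϑ₁ g ⊗ₖ (1 : Matrix m₁ m₁ ℂ)) = (ϑ₂ g ⊗ₖ (1 : Matrix m₂ m₂ ℂ)) * Y) :
    Y = 0 := by
  ext ⟨s, a⟩ ⟨t, b⟩
  have h0 : slice Y a b = 0 := intertwiner_eq_zero h₁ h₂ hne (slice_intertwines hY a b)
  have := congrFun (congrFun h0 s) t
  simpa using this

/-- **Schur, Kronecker form (2)**: an intertwiner of `ϑ ⊗ 1_{m₁}` and `ϑ ⊗ 1_{m₂}` for an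
irreducible `ϑ` is `1 ⊗ B` — each diagonal block of GP04's `T⁻¹ X T` consists of `dim ϑ` equal
copies of one `m × m` matrix `B`. [cite: GatermannParrilo2004, §4 (block form of `T⁻¹XT`); Serre1977,
§2.2 Prop. 4] -/
theorem exists_eq_one_kronecker {ϑ : G →* Matrix p p ℂ} (h : IsIrrep ϑ)
    {Y : Matrix (p × m₂) (p × m₁) ℂ}
    (hY : ∀ g, Y * (ϑ g ⊗ₖ (1 : Matrix m₁ m₁ ℂ)) = (ϑ g ⊗ₖ (1 : Matrix m₂ m₂ ℂ)) * Y) :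
    ∃ B : Matrix m₂ m₁ ℂ, Y = (1 : Matrix p p ℂ) ⊗ₖ B := by
  have hc : ∀ a b, ∃ c : ℂ, slice Y a b = c • (1 : Matrix p p ℂ) := fun a b =>
    exists_eq_smul_one_of_comm h (slice_intertwines hY a b)
  choose c hc using hc
  refine ⟨Matrix.of fun a b => c a b, ?_⟩
  ext ⟨s, a⟩ ⟨t, b⟩
  have := congrFun (congrFun (hc a b) s) t
  simp only [slice_apply, Matrix.smul_apply, smul_eq_mul] at this
  simp only [this, Matrix.kroneckerMap_apply, Matrix.of_apply, Matrix.one_apply]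
  split_ifs <;> simp

end KroneckerSchur

/-! ## 3. The block representation `⊕ᵢ (ϑᵢ ⊗ 1_{mᵢ})` and its commutant `⊕ᵢ (1_{dᵢ} ⊗ Bᵢ)` -/

section SigmaMul

variable {I : Type*} [Fintype I] [DecidableEq I] {α : I → Type*} [∀ i, Fintype (α i)]

/-- Entries of `Y * blockDiagonal' M` on a `Σ`-indexed matrix, without dependent casts.
[folklore] -/
private theorem mul_blockDiagonal'_apply (Y : Matrix (Σ i, α i) (Σ i, α i) ℂ)
    (M : ∀ i, Matrix (α i) (α i) ℂ) (i : I) (x : α i) (j : I) (y : α j) :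
    (Y * Matrix.blockDiagonal' M) ⟨i, x⟩ ⟨j, y⟩ = ∑ z : α j, Y ⟨i, x⟩ ⟨j, z⟩ * M j z y := by
  rw [Matrix.mul_apply, ← Finset.univ_sigma_univ, Finset.sum_sigma]
  rw [Finset.sum_eq_single j]
  · refine Finset.sum_congr rfl fun z _ => ?_
    rw [Matrix.blockDiagonal'_apply_eq]
  · intro k _ hk
    refine Finset.sum_eq_zero fun z _ => ?_
    rw [Matrix.blockDiagonal'_apply_ne M z y hk, mul_zero]
  · intro h; exact absurd (Finset.mem_univ j) h

/-- Entries of `blockDiagonal' M * Y` on a `Σ`-indexed matrix, without dependent casts.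
[folklore] -/
private theorem blockDiagonal'_mul_apply (Y : Matrix (Σ i, α i) (Σ i, α i) ℂ)
    (M : ∀ i, Matrix (α i) (α i) ℂ) (i : I) (x : α i) (j : I) (y : α j) :
    (Matrix.blockDiagonal' M * Y) ⟨i, x⟩ ⟨j, y⟩ = ∑ z : α i, M i x z * Y ⟨i, z⟩ ⟨j, y⟩ := by
  rw [Matrix.mul_apply, ← Finset.univ_sigma_univ, Finset.sum_sigma]
  rw [Finset.sum_eq_single i]
  · refine Finset.sum_congr rfl fun z _ => ?_
    rw [Matrix.blockDiagonal'_apply_eq]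
  · intro k _ hk
    refine Finset.sum_eq_zero fun z _ => ?_
    rw [Matrix.blockDiagonal'_apply_ne M x z (Ne.symm hk), zero_mul]
  · intro h; exact absurd (Finset.mem_univ i) h

end SigmaMul

section Blocks

variable {I : Type*} {d m : I → Type*}

/-- The index type of a symmetry-adapted basis: for each irreducible label `i`, pairs
(coordinate of `ϑᵢ`, copy number). [cite: GatermannParrilo2004, §4 (isotypic decomposition)] -/
abbrev BlockIndex (d m : I → Type*) := Σ i, d i × m i

/-- The `(i, j)` block of a matrix in symmetry-adapted coordinates. [folklore] -/
def block (Y : Matrix (BlockIndex d m) (BlockIndex d m) ℂ) (i j : I) :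
    Matrix (d i × m i) (d j × m j) ℂ :=
  Matrix.of fun x y => Y ⟨i, x⟩ ⟨j, y⟩

/-- Entries of a block. [folklore] -/
@[simp] private theorem block_apply (Y : Matrix (BlockIndex d m) (BlockIndex d m) ℂ) (i j : I)
    (x : d i × m i) (y : d j × m j) : block Y i j x y = Y ⟨i, x⟩ ⟨j, y⟩ := rfl

variable [Fintype I] [DecidableEq I]
variable [∀ i, Fintype (d i)] [∀ i, DecidableEq (d i)] [∀ i, Fintype (m i)] [∀ i, DecidableEq (m i)]

/-- The representation in symmetry-adapted coordinates: `g ↦ ⊕ᵢ (ϑᵢ(g) ⊗ 1_{mᵢ})`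
(`ρ = m₁ ϑ₁ ⊕ ⋯ ⊕ m_h ϑ_h`). [cite: GatermannParrilo2004, §4 (canonical decomposition)] -/
def blockRep (ϑ : ∀ i, G →* Matrix (d i) (d i) ℂ) (m : I → Type*) [∀ i, Fintype (m i)]
    [∀ i, DecidableEq (m i)] : G →* Matrix (BlockIndex d m) (BlockIndex d m) ℂ where
  toFun g := Matrix.blockDiagonal' fun i => ϑ i g ⊗ₖ (1 : Matrix (m i) (m i) ℂ)
  map_one' := by
    simp only [map_one, Matrix.one_kronecker_one]
    exact Matrix.blockDiagonal'_one
  map_mul' a b := by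
    rw [← Matrix.blockDiagonal'_mul]
    congr 1
    funext i
    rw [map_mul, ← Matrix.mul_kronecker_mul, Matrix.one_mul]

/-- `blockRep ϑ m g = ⊕ᵢ (ϑᵢ(g) ⊗ 1)`. [cite: GatermannParrilo2004, §4 (canonical decomposition)] -/
@[simp] theorem blockRep_apply (ϑ : ∀ i, G →* Matrix (d i) (d i) ℂ) (g : G) :
    blockRep ϑ m g = Matrix.blockDiagonal' fun i => ϑ i g ⊗ₖ (1 : Matrix (m i) (m i) ℂ) := rfl

/-- The block embedding `B = (Bᵢ)ᵢ ↦ ⊕ᵢ (1_{dᵢ} ⊗ Bᵢ)` — GP04's block form of `T⁻¹XT`: one block per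
irreducible, consisting of `dim ϑᵢ` equal copies of `Bᵢ` — as a unital `*`-algebra
homomorphism `⊕ᵢ ℂ^{mᵢ×mᵢ} → ℂ^{N×N}`. [cite: GatermannParrilo2004, §4 (block form of `T⁻¹XT`)] -/
def blockLift (d m : I → Type*) [∀ i, Fintype (d i)] [∀ i, DecidableEq (d i)]
    [∀ i, Fintype (m i)] [∀ i, DecidableEq (m i)] :
    (∀ i, Matrix (m i) (m i) ℂ) →⋆ₐ[ℂ] Matrix (BlockIndex d m) (BlockIndex d m) ℂ where
  toFun B := Matrix.blockDiagonal' fun i => (1 : Matrix (d i) (d i) ℂ) ⊗ₖ B i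
  map_one' := by
    simp only [Pi.one_apply, Matrix.one_kronecker_one]
    exact Matrix.blockDiagonal'_one
  map_mul' B C := by
    rw [← Matrix.blockDiagonal'_mul]
    congr 1
    funext i
    simp only [Pi.mul_apply, ← Matrix.mul_kronecker_mul, Matrix.one_mul]
  map_zero' := by
    simp only [Pi.zero_apply, Matrix.kronecker_zero]
    exact Matrix.blockDiagonal'_zero
  map_add' B C := by
    rw [← Matrix.blockDiagonal'_add]
    congr 1
    funext i
    simp only [Pi.add_apply, Matrix.kronecker_add]
  commutes' c := by
    rw [Algebra.algebraMap_eq_smul_one, Algebra.algebraMap_eq_smul_one]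
    simp only [Pi.smul_apply, Pi.one_apply, Matrix.kronecker_smul, Matrix.one_kronecker_one]
    rw [show (fun i => c • (1 : Matrix (d i × m i) (d i × m i) ℂ)) =
        c • (fun i => (1 : Matrix (d i × m i) (d i × m i) ℂ)) from rfl,
      Matrix.blockDiagonal'_smul]
    congr 1
    exact Matrix.blockDiagonal'_one
  map_star' B := by
    simp only [Matrix.star_eq_conjTranspose, Matrix.blockDiagonal'_conjTranspose]
    congr 1
    funext i
    rw [Pi.star_apply, Matrix.star_eq_conjTranspose, Matrix.conjTranspose_kronecker,
      Matrix.conjTranspose_one]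

/-- `blockLift d m B = ⊕ᵢ (1 ⊗ Bᵢ)`. [cite: GatermannParrilo2004, §4 (block form of `T⁻¹XT`)] -/
theorem blockLift_apply (B : ∀ i, Matrix (m i) (m i) ℂ) :
    blockLift d m B = Matrix.blockDiagonal' fun i => (1 : Matrix (d i) (d i) ℂ) ⊗ₖ B i := rfl

/-- The block embedding is injective (every irreducible has positive dimension). [folklore] -/
private theorem blockLift_injective [∀ i, Nonempty (d i)] : Function.Injective (blockLift d m) := by
  intro B C h
  funext i
  have h2 : (Matrix.blockDiagonal' fun i => (1 : Matrix (d i) (d i) ℂ) ⊗ₖ B i) =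
      Matrix.blockDiagonal' fun i => (1 : Matrix (d i) (d i) ℂ) ⊗ₖ C i := h
  have h' := congrFun (Matrix.blockDiagonal'_injective h2) i
  exact one_kronecker_injective h'

/-- Everything of the form `⊕ᵢ (1 ⊗ Bᵢ)` commutes with the representation `⊕ᵢ (ϑᵢ ⊗ 1)`:
`(1 ⊗ B)(ϑ ⊗ 1) = ϑ ⊗ B = (ϑ ⊗ 1)(1 ⊗ B)`. [cite: GatermannParrilo2004, §4 (commutation relation and block form)] -/
theorem blockLift_comm (ϑ : ∀ i, G →* Matrix (d i) (d i) ℂ) (B : ∀ i, Matrix (m i) (m i) ℂ)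
    (g : G) : blockLift d m B * blockRep ϑ m g = blockRep ϑ m g * blockLift d m B := by
  rw [blockLift_apply, blockRep_apply, ← Matrix.blockDiagonal'_mul, ← Matrix.blockDiagonal'_mul]
  congr 1
  funext i
  rw [← Matrix.mul_kronecker_mul, ← Matrix.mul_kronecker_mul, Matrix.one_mul, Matrix.mul_one,
    Matrix.one_mul, Matrix.mul_one]

/-- `⊕ᵢ (ϑᵢ ⊗ Bᵢ)`: the product of the representation matrix and a commutant element.
[cite: GatermannParrilo2004, §4 (block form of `T⁻¹XT`)] -/
theorem blockRep_mul_blockLift (ϑ : ∀ i, G →* Matrix (d i) (d i) ℂ)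
    (B : ∀ i, Matrix (m i) (m i) ℂ) (g : G) :
    blockRep ϑ m g * blockLift d m B = Matrix.blockDiagonal' fun i => ϑ i g ⊗ₖ B i := by
  rw [blockLift_apply, blockRep_apply, ← Matrix.blockDiagonal'_mul]
  congr 1
  funext i
  rw [← Matrix.mul_kronecker_mul, Matrix.one_mul, Matrix.mul_one]

/-- The blocks of a matrix commuting with `⊕ᵢ (ϑᵢ ⊗ 1)` intertwine `ϑⱼ ⊗ 1` and `ϑᵢ ⊗ 1`.
[cite: GatermannParrilo2004, §4 (commutation relation `ρ(g)X = Xρ(g)`)] -/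
theorem block_intertwines {ϑ : ∀ i, G →* Matrix (d i) (d i) ℂ}
    {Y : Matrix (BlockIndex d m) (BlockIndex d m) ℂ}
    (hY : ∀ g, Y * blockRep ϑ m g = blockRep ϑ m g * Y) (i j : I) (g : G) :
    block Y i j * (ϑ j g ⊗ₖ (1 : Matrix (m j) (m j) ℂ)) =
      (ϑ i g ⊗ₖ (1 : Matrix (m i) (m i) ℂ)) * block Y i j := by
  ext x y
  have h := congrFun (congrFun (hY g) ⟨i, x⟩) ⟨j, y⟩
  rw [blockRep_apply, mul_blockDiagonal'_apply, blockDiagonal'_mul_apply] at h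
  simpa [Matrix.mul_apply] using h

/-- **Block diagonalisation of the commutant (Gatermann–Parrilo Thm 4.1, second half).** If the
`ϑᵢ` are irreducible and pairwise non-equivalent, a matrix commutes with the representation
`⊕ᵢ (ϑᵢ ⊗ 1_{mᵢ})` (GP04 §4: `ρ(g) X = X ρ(g)`) if and only if it has the block form
`⊕ᵢ (1_{dᵢ} ⊗ Bᵢ)` displayed in GP04 §4: block diagonal with one block per irreducible `ϑᵢ`, itself
consisting of `dᵢ = dim ϑᵢ` equal diagonal copies of an `mᵢ × mᵢ` matrix `Bᵢ`.
[cite: GatermannParrilo2004, §4 Thm 4.1 (block form of `T⁻¹XT`); Serre1977, §2.2 Prop. 4] -/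
theorem comm_blockRep_iff {ϑ : ∀ i, G →* Matrix (d i) (d i) ℂ} (hirr : ∀ i, IsIrrep (ϑ i))
    (hne : Pairwise fun i j => ¬ AreEquivalent (ϑ i) (ϑ j))
    (Y : Matrix (BlockIndex d m) (BlockIndex d m) ℂ) :
    (∀ g, Y * blockRep ϑ m g = blockRep ϑ m g * Y) ↔
      ∃ B : ∀ i, Matrix (m i) (m i) ℂ, Y = blockLift d m B := by
  constructor
  · intro hY
    have hdiag : ∀ i, ∃ B : Matrix (m i) (m i) ℂ,
        block Y i i = (1 : Matrix (d i) (d i) ℂ) ⊗ₖ B :=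
      fun i => exists_eq_one_kronecker (hirr i) (block_intertwines hY i i)
    choose B hB using hdiag
    refine ⟨B, ?_⟩
    ext ⟨i, x⟩ ⟨j, y⟩
    rw [blockLift_apply]
    by_cases hij : i = j
    · subst hij
      simp only [Matrix.blockDiagonal'_apply_eq]
      rw [← hB i, block_apply]
    · rw [Matrix.blockDiagonal'_apply_ne _ _ _ hij]
      have h0 : block Y i j = 0 :=
        eq_zero_of_kronecker_intertwiner (hirr j) (hirr i) (hne (Ne.symm hij))
          (block_intertwines hY i j)
      have := congrFun (congrFun h0 x) y
      simpa using this
  · rintro ⟨B, rfl⟩ g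
    exact blockLift_comm ϑ B g

/-- The commutant in symmetry-adapted coordinates is exactly the range of the block embedding.
[cite: GatermannParrilo2004, §4 Thm 4.1] -/
theorem centralizer_range_blockRep_eq {ϑ : ∀ i, G →* Matrix (d i) (d i) ℂ}
    (hirr : ∀ i, IsIrrep (ϑ i)) (hne : Pairwise fun i j => ¬ AreEquivalent (ϑ i) (ϑ j)) :
    Subalgebra.centralizer ℂ (Set.range (blockRep ϑ m)) = (blockLift d m).range.toSubalgebra := by
  ext Y
  rw [Subalgebra.mem_centralizer_iff]
  change _ ↔ Y ∈ (blockLift d m).toAlgHom.range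
  rw [AlgHom.mem_range]
  constructor
  · intro h
    have h' : ∀ g, Y * blockRep ϑ m g = blockRep ϑ m g * Y := fun g => (h _ ⟨g, rfl⟩).symm
    obtain ⟨B, rfl⟩ := (comm_blockRep_iff hirr hne Y).1 h'
    exact ⟨B, rfl⟩
  · rintro ⟨B, rfl⟩ _ ⟨g, rfl⟩
    exact (blockLift_comm ϑ B g).symm

end Blocks

/-! ## 4. Traces against the block form: the reduced objective and constraints -/

section Traces

variable {I : Type*} {d m : I → Type*}

/-- Folding a matrix in symmetry-adapted coordinates onto the multiplicity spaces: the `i`-th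
REDUCED DATA MATRIX `Σₛ A[(i,s,·),(i,s,·)]` (partial trace over the coordinate of `ϑᵢ`); for
`A = ⊕ᵢ (1 ⊗ Cᵢ)` it is `dᵢ • Cᵢ` (`traceFold_blockLift`). This is how the data `C, A_k` of an
invariant SDP enter the reduced program of GP04 Thm 4.1. [cite: GatermannParrilo2004, §4 Thm 4.1
(objective `Σᵢ nᵢ ⟨Cᵢ, Xᵢ⟩`)] -/
def traceFold [∀ i, Fintype (d i)] (A : Matrix (BlockIndex d m) (BlockIndex d m) ℂ) (i : I) :
    Matrix (m i) (m i) ℂ :=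
  ∑ s : d i, Matrix.of fun a b => A ⟨i, (s, a)⟩ ⟨i, (s, b)⟩

/-- Entries of the folded matrix. [folklore] -/
private theorem traceFold_apply [∀ i, Fintype (d i)] (A : Matrix (BlockIndex d m) (BlockIndex d m) ℂ)
    (i : I) (a b : m i) : traceFold A i a b = ∑ s : d i, A ⟨i, (s, a)⟩ ⟨i, (s, b)⟩ := by
  simp [traceFold, Matrix.sum_apply]

variable [Fintype I] [DecidableEq I]
variable [∀ i, Fintype (d i)] [∀ i, DecidableEq (d i)] [∀ i, Fintype (m i)] [∀ i, DecidableEq (m i)]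

/-- **Trace against a block-form matrix.** For ANY `A` (e.g. `A = T⁻¹ A_k T` for a constraint
matrix `A_k` of the original SDP) and a commutant element in block form,
`tr(A · ⊕ᵢ(1 ⊗ Bᵢ)) = Σᵢ tr(foldᵢ(A) Bᵢ)`: linear constraints and the objective of the invariant
SDP become constraints on the small blocks `Bᵢ`. [cite: GatermannParrilo2004, §4 Thm 4.1] -/
theorem trace_mul_blockLift (A : Matrix (BlockIndex d m) (BlockIndex d m) ℂ)
    (B : ∀ i, Matrix (m i) (m i) ℂ) :
    (A * blockLift d m B).trace = ∑ i, (traceFold A i * B i).trace := by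
  simp only [Matrix.trace, Matrix.diag_apply]
  rw [Fintype.sum_sigma]
  refine Finset.sum_congr rfl fun i _ => ?_
  simp only [blockLift_apply, mul_blockDiagonal'_apply]
  simp only [Matrix.mul_apply, traceFold_apply, Finset.sum_mul, Fintype.sum_prod_type_right,
    Matrix.kroneckerMap_apply, Matrix.one_apply, ite_mul, one_mul, zero_mul, mul_ite, mul_zero,
    Finset.sum_ite_eq', Finset.mem_univ, if_true]
  exact Finset.sum_congr rfl fun a _ => Finset.sum_comm

/-- Folding a block-form matrix returns `dᵢ` copies of its block: `foldᵢ(⊕ⱼ(1 ⊗ Cⱼ)) = dᵢ • Cᵢ`.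
[cite: GatermannParrilo2004, §4 Thm 4.1 (the factor `nᵢ`)] -/
theorem traceFold_blockLift (C : ∀ i, Matrix (m i) (m i) ℂ) (i : I) :
    traceFold (blockLift d m C) i = (Fintype.card (d i) : ℂ) • C i := by
  ext a b
  simp [traceFold_apply, blockLift_apply, Matrix.blockDiagonal'_apply_eq,
    Matrix.kroneckerMap_apply, Finset.sum_const, Finset.card_univ]

/-- **The reduced objective (GP04 Thm 4.1, the reduced program):** if both the cost matrix and the variable
are in block form, `C ↦ (Cᵢ)`, `X ↦ (Bᵢ)`, then `⟨C, X⟩ = Σᵢ dᵢ ⟨Cᵢ, Bᵢ⟩` with `dᵢ = dim ϑᵢ`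
(GP04's `Σᵢ nᵢ ⟨Cᵢ, Xᵢ⟩`). [cite: GatermannParrilo2004, §4 Thm 4.1] -/
theorem trace_blockLift_mul_blockLift (C B : ∀ i, Matrix (m i) (m i) ℂ) :
    (blockLift d m C * blockLift d m B).trace =
      ∑ i, (Fintype.card (d i) : ℂ) * (C i * B i).trace := by
  rw [trace_mul_blockLift]
  refine Finset.sum_congr rfl fun i _ => ?_
  rw [traceFold_blockLift, Matrix.smul_mul, Matrix.trace_smul, smul_eq_mul]

/-- `tr(⊕ᵢ(1 ⊗ Bᵢ)) = Σᵢ dᵢ tr(Bᵢ)`. [cite: GatermannParrilo2004, §4 Thm 4.1] -/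
theorem trace_blockLift (B : ∀ i, Matrix (m i) (m i) ℂ) :
    (blockLift d m B).trace = ∑ i, (Fintype.card (d i) : ℂ) * (B i).trace := by
  have h := trace_blockLift_mul_blockLift (d := d) (m := m) 1 B
  simpa only [map_one, Matrix.one_mul, Pi.one_apply] using h

/-- `⊕ᵢ(1 ⊗ Bᵢ) ⪰ 0 ↔ ∀ i, Bᵢ ⪰ 0` (all `dᵢ ≥ 1`): the big semidefinite constraint splits into
one small constraint per irreducible (GP04 Remark 4.2: "instead of a large SDP of dimension
`Σᵢ nᵢ mᵢ` we solve `h` coupled SDPs of dimension `mᵢ`"). [cite: GatermannParrilo2004, §4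
Thm 4.1 and Remark 4.2] -/
theorem posSemidef_blockLift_iff [∀ i, Nonempty (d i)] (B : ∀ i, Matrix (m i) (m i) ℂ) :
    (blockLift d m B).PosSemidef ↔ ∀ i, (B i).PosSemidef := by
  rw [blockLift_apply, MatrixStarAlgebra.posSemidef_blockDiagonal'_iff]
  refine forall_congr' fun i => ⟨fun h => ?_, fun h => Matrix.PosSemidef.one.kronecker h⟩
  obtain ⟨s⟩ := ‹∀ i, Nonempty (d i)› i
  have e : ((1 : Matrix (d i) (d i) ℂ) ⊗ₖ B i).submatrix (fun a => (s, a)) (fun a => (s, a)) =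
      B i := by
    ext a b
    simp [Matrix.kroneckerMap_apply]
  rw [← e]
  exact h.submatrix _

/-- `⊕ᵢ(1 ⊗ Bᵢ)` is Hermitian iff every `Bᵢ` is — the reduced variables of GP04 Thm 4.1 live in
`S^{mᵢ}` (symmetric/Hermitian blocks). [cite: GatermannParrilo2004, §4 Thm 4.1 (`Xᵢ ∈ S^{mᵢ}`)] -/
theorem isHermitian_blockLift_iff [∀ i, Nonempty (d i)] (B : ∀ i, Matrix (m i) (m i) ℂ) :
    (blockLift d m B).IsHermitian ↔ ∀ i, (B i).IsHermitian := by
  have hstar : (blockLift d m B)ᴴ = blockLift d m (star B) := by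
    rw [← Matrix.star_eq_conjTranspose, ← map_star]
  constructor
  · intro h i
    have h1 : blockLift d m (star B) = blockLift d m B := by rw [← hstar]; exact h
    have h2 := congrFun (blockLift_injective h1) i
    simpa [Matrix.IsHermitian, Matrix.star_eq_conjTranspose] using h2
  · intro h
    change (blockLift d m B)ᴴ = blockLift d m B
    rw [hstar]
    congr 1
    funext i
    exact h i

end Traces

/-! ## 5. Symmetry-adapted coordinates for a representation `ρ` (GP04 Theorem 4.1) -/

section Adapted

variable {n : Type*} [Fintype n] [DecidableEq n]
variable {I : Type*} [Fintype I] [DecidableEq I]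
variable {d : I → Type*} [∀ i, Fintype (d i)] [∀ i, DecidableEq (d i)]
variable {m : I → Type*} [∀ i, Fintype (m i)] [∀ i, DecidableEq (m i)]

/-- A **symmetry-adapted change of coordinates** for a matrix representation `ρ : G →* ℂ^{n×n}`
(GP04 §4: "a basis of this decomposition transforming with respect to the matrices `ϑᵢ(g)` is
called symmetry adapted … this basis defines a change of coordinates by a matrix `T` collecting
the basis as columns"): an invertible `T` with inverse `T'` under which `ρ` becomes
`⊕ᵢ (ϑᵢ ⊗ 1_{mᵢ})` for irreducible, pairwise non-equivalent `ϑᵢ` (multiplicities `mᵢ = |m i|`,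
degrees `dᵢ = |d i|`). [cite: GatermannParrilo2004, §4 (before Thm 4.1); Serre1977, §2.6–2.7] -/
structure IsSymmetryAdapted (ρ : G →* Matrix n n ℂ) (ϑ : ∀ i, G →* Matrix (d i) (d i) ℂ)
    (m : I → Type*) [∀ i, Fintype (m i)] [∀ i, DecidableEq (m i)]
    (T : Matrix n (BlockIndex d m) ℂ) (T' : Matrix (BlockIndex d m) n ℂ) : Prop where
  mul_inv : T * T' = 1
  inv_mul : T' * T = 1
  adapted : ∀ g, T' * ρ g * T = blockRep ϑ m g
  irreducible : ∀ i, IsIrrep (ϑ i)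
  not_equivalent : Pairwise fun i j => ¬ AreEquivalent (ϑ i) (ϑ j)

namespace IsSymmetryAdapted

variable {ρ : G →* Matrix n n ℂ} {ϑ : ∀ i, G →* Matrix (d i) (d i) ℂ}
variable {T : Matrix n (BlockIndex d m) ℂ} {T' : Matrix (BlockIndex d m) n ℂ}

/-- `ρ(g) = T (⊕ᵢ ϑᵢ(g) ⊗ 1) T⁻¹`. [folklore] -/
private theorem rho_eq (h : IsSymmetryAdapted ρ ϑ m T T') (g : G) : ρ g = T * blockRep ϑ m g * T' := by
  rw [← h.adapted g]
  calc ρ g = (T * T') * ρ g * (T * T') := by rw [h.mul_inv, Matrix.one_mul, Matrix.mul_one]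
    _ = T * (T' * ρ g * T) * T' := by simp only [Matrix.mul_assoc]

/-- `X = T (T⁻¹ X T) T⁻¹`. [folklore] -/
private theorem eq_conj (h : IsSymmetryAdapted ρ ϑ m T T') (X : Matrix n n ℂ) :
    X = T * (T' * X * T) * T' := by
  calc X = (T * T') * X * (T * T') := by rw [h.mul_inv, Matrix.one_mul, Matrix.mul_one]
    _ = T * (T' * X * T) * T' := by simp only [Matrix.mul_assoc]

/-- Conjugation transports commutation with `ρ` to commutation with the block representation.
[folklore] -/
private theorem comm_iff_conj_comm (h : IsSymmetryAdapted ρ ϑ m T T') (X : Matrix n n ℂ) :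
    (∀ g, X * ρ g = ρ g * X) ↔ ∀ g, (T' * X * T) * blockRep ϑ m g = blockRep ϑ m g * (T' * X * T) := by
  constructor
  · intro hX g
    rw [← h.adapted g]
    calc T' * X * T * (T' * ρ g * T) = T' * X * (T * T') * ρ g * T := by
          simp only [Matrix.mul_assoc]
      _ = T' * (X * ρ g) * T := by rw [h.mul_inv, Matrix.mul_one]; simp only [Matrix.mul_assoc]
      _ = T' * (ρ g * X) * T := by rw [hX g]
      _ = T' * ρ g * (T * T') * X * T := by rw [h.mul_inv, Matrix.mul_one]; simp only [Matrix.mul_assoc]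
      _ = T' * ρ g * T * (T' * X * T) := by simp only [Matrix.mul_assoc]
  · intro hY g
    rw [h.eq_conj X, h.rho_eq g]
    calc T * (T' * X * T) * T' * (T * blockRep ϑ m g * T')
          = T * ((T' * X * T) * (T' * T) * blockRep ϑ m g) * T' := by simp only [Matrix.mul_assoc]
      _ = T * ((T' * X * T) * blockRep ϑ m g) * T' := by rw [h.inv_mul, Matrix.mul_one]
      _ = T * (blockRep ϑ m g * (T' * X * T)) * T' := by rw [hY g]
      _ = T * (blockRep ϑ m g * (T' * T) * (T' * X * T)) * T' := by rw [h.inv_mul, Matrix.mul_one]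
      _ = T * blockRep ϑ m g * T' * (T * (T' * X * T) * T') := by simp only [Matrix.mul_assoc]

/-- **Gatermann–Parrilo Theorem 4.1 (block diagonalisation of invariant matrices).** In
symmetry-adapted coordinates every matrix commuting with the representation — i.e. every point
of the fixed-point subspace of the induced action `X ↦ ρ(g)ᵀ X ρ(g)`, GP04 §4 — is block
diagonal of the displayed form `T⁻¹ X T = ⊕ᵢ (1_{dᵢ} ⊗ Bᵢ)`, and conversely.
[cite: GatermannParrilo2004, §4 Thm 4.1] -/
theorem comm_iff (h : IsSymmetryAdapted ρ ϑ m T T') (X : Matrix n n ℂ) :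
    (∀ g, X * ρ g = ρ g * X) ↔ ∃ B : ∀ i, Matrix (m i) (m i) ℂ, T' * X * T = blockLift d m B := by
  rw [h.comm_iff_conj_comm X, comm_blockRep_iff h.irreducible h.not_equivalent]

/-- The commuting matrices are exactly `T (⊕ᵢ(1 ⊗ Bᵢ)) T⁻¹`. [cite: GatermannParrilo2004, §4
Thm 4.1] -/
theorem comm_iff' (h : IsSymmetryAdapted ρ ϑ m T T') (X : Matrix n n ℂ) :
    (∀ g, X * ρ g = ρ g * X) ↔
      ∃ B : ∀ i, Matrix (m i) (m i) ℂ, X = T * blockLift d m B * T' := by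
  rw [h.comm_iff X]
  refine exists_congr fun B => ⟨fun hB => ?_, fun hB => ?_⟩
  · rw [← hB]; exact h.eq_conj X
  · rw [hB]
    calc T' * (T * blockLift d m B * T') * T = (T' * T) * blockLift d m B * (T' * T) := by
          simp only [Matrix.mul_assoc]
      _ = blockLift d m B := by rw [h.inv_mul, Matrix.one_mul, Matrix.mul_one]

/-! ### Unitary symmetry-adapted coordinates: the reduced semidefinite program -/

/-- **GP04 Theorem 4.1, the semidefinite constraint.** For a UNITARY symmetry-adapted `T`
(`T' = Tᴴ`; GP04: "since `ρ` is assumed to be orthogonal the matrix `T` can also be chosen to be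
orthogonal") an invariant `X` with blocks `Bᵢ` is positive semidefinite iff every `Bᵢ` is:
`X ⪰ 0 ↔ ∀ i, Bᵢ ⪰ 0` — "the semidefinite program can be simplified to
`min Σᵢ nᵢ ⟨Cᵢ, Xᵢ⟩, Xᵢ ∈ S^{mᵢ}_+`". [cite: GatermannParrilo2004, §4 Thm 4.1] -/
theorem posSemidef_iff (h : IsSymmetryAdapted ρ ϑ m T Tᴴ) [∀ i, Nonempty (d i)]
    {X : Matrix n n ℂ} {B : ∀ i, Matrix (m i) (m i) ℂ} (hB : Tᴴ * X * T = blockLift d m B) :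
    X.PosSemidef ↔ ∀ i, (B i).PosSemidef := by
  rw [← posSemidef_blockLift_iff (d := d) B, ← hB]
  constructor
  · intro hX
    simpa only [Matrix.conjTranspose_conjTranspose] using hX.conjTranspose_mul_mul_same T
  · intro hY
    have hX : X = T * (Tᴴ * X * T) * Tᴴ := h.eq_conj X
    rw [hX]
    exact hY.mul_mul_conjTranspose_same T

/-- For unitary symmetry-adapted `T`: `X` is Hermitian iff all its blocks are ("symmetric matrices
`A` are transformed to symmetric matrices `TᵀAT`"; the reduced variables `Xᵢ ∈ S^{mᵢ}`).
[cite: GatermannParrilo2004, §4 Thm 4.1 (`Xᵢ ∈ S^{mᵢ}`)] -/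
theorem isHermitian_iff (h : IsSymmetryAdapted ρ ϑ m T Tᴴ) [∀ i, Nonempty (d i)]
    {X : Matrix n n ℂ} {B : ∀ i, Matrix (m i) (m i) ℂ} (hB : Tᴴ * X * T = blockLift d m B) :
    X.IsHermitian ↔ ∀ i, (B i).IsHermitian := by
  rw [← isHermitian_blockLift_iff (d := d) B, ← hB]
  constructor
  · intro hX
    simpa only [Matrix.conjTranspose_conjTranspose] using
      Matrix.isHermitian_conjTranspose_mul_mul T hX
  · intro hY
    have hX : X = T * (Tᴴ * X * T) * Tᴴ := h.eq_conj X
    rw [hX]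
    exact Matrix.isHermitian_mul_mul_conjTranspose T hY

/-- **GP04 Theorem 4.1, linear data.** For unitary symmetry-adapted `T`, any data matrix `A`
(objective or constraint, invariant or not) pairs with an invariant `X = T (⊕ᵢ 1 ⊗ Bᵢ) Tᴴ` through
the folded blocks of `Tᴴ A T`: `tr(A X) = Σᵢ tr(foldᵢ(Tᴴ A T) Bᵢ)` — "the change of coordinates
affects both the explicit description of the affine linear space `𝓛` and the cost function".
[cite: GatermannParrilo2004, §4 Thm 4.1] -/
theorem trace_mul_eq (h : IsSymmetryAdapted ρ ϑ m T Tᴴ) (A : Matrix n n ℂ) {X : Matrix n n ℂ}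
    {B : ∀ i, Matrix (m i) (m i) ℂ} (hB : Tᴴ * X * T = blockLift d m B) :
    (A * X).trace = ∑ i, (traceFold (Tᴴ * A * T) i * B i).trace := by
  rw [← trace_mul_blockLift, ← hB]
  have hX : X = T * (Tᴴ * X * T) * Tᴴ := h.eq_conj X
  conv_lhs => rw [hX]
  calc (A * (T * (Tᴴ * X * T) * Tᴴ)).trace = ((A * T * (Tᴴ * X * T)) * Tᴴ).trace := by
        simp only [Matrix.mul_assoc]
    _ = (Tᴴ * (A * T * (Tᴴ * X * T))).trace := Matrix.trace_mul_comm _ _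
    _ = (Tᴴ * A * T * (Tᴴ * X * T)).trace := by simp only [Matrix.mul_assoc]

/-- **GP04 Theorem 4.1, the reduced objective `Σᵢ nᵢ ⟨Cᵢ, Xᵢ⟩`.** If the cost matrix is itself
invariant with blocks `Cᵢ` (as it may be assumed after group averaging, GP04 §3), then
`⟨C, X⟩ = Σᵢ dᵢ · tr(Cᵢ Bᵢ)`. [cite: GatermannParrilo2004, §4 Thm 4.1] -/
theorem trace_mul_eq_sum_card (h : IsSymmetryAdapted ρ ϑ m T Tᴴ) {C X : Matrix n n ℂ}
    {Cb B : ∀ i, Matrix (m i) (m i) ℂ} (hC : Tᴴ * C * T = blockLift d m Cb)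
    (hB : Tᴴ * X * T = blockLift d m B) :
    (C * X).trace = ∑ i, (Fintype.card (d i) : ℂ) * (Cb i * B i).trace := by
  rw [h.trace_mul_eq C hB, hC]
  refine Finset.sum_congr rfl fun i _ => ?_
  rw [traceFold_blockLift, Matrix.smul_mul, Matrix.trace_smul, smul_eq_mul]

end IsSymmetryAdapted

end Adapted

/-! ## 6. Existence of symmetry-adapted bases (named fact) -/

/-- **Existence of a unitary symmetry-adapted basis (Gatermann–Parrilo Thm 4.1, first half;
Serre §2.6 Thm 8 / §2.7 Prop. 8; Fässler–Stiefel).** For every UNITARY matrix representation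
`ρ` of a FINITE group on `ℂⁿ` there are: finitely many irreducible, pairwise non-equivalent
unitary matrix representations `ϑᵢ` (degrees `dᵢ`), multiplicity index types `m i`, and a
UNITARY `T : ℂⁿ ≃ ⊕ᵢ (ℂ^{dᵢ} ⊗ ℂ^{mᵢ})` (`T Tᴴ = 1 = Tᴴ T`, part of `IsSymmetryAdapted ρ ϑ m T Tᴴ`)
with `Tᴴ ρ(g) T = ⊕ᵢ (ϑᵢ(g) ⊗ 1_{mᵢ})` for all `g`
("there exists an explicitly computable coordinate transformation under which all invariant
matrices are block diagonal"). Recorded as a NAMED FACT (hypothesis `(h : …)`), not proved in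
this file: the proof is the canonical (isotypic) decomposition [Serre §2.6–2.7], with `T`
unitary because invariant subspaces of a unitary representation have invariant orthogonal
complements and an intertwiner between equivalent unitary irreducibles can be rescaled to be
unitary (Schur). [cite: GatermannParrilo2004, §4 Thm 4.1; Serre1977, §2.6 Thm 8, §2.7 Prop. 8] -/
def UnitarySymmetryAdaptedBasisExists (G : Type*) [Group G] [Finite G] (n : Type*) [Fintype n]
    [DecidableEq n] : Prop :=
  ∀ ρ : G →* Matrix n n ℂ, (∀ g, (ρ g)ᴴ * ρ g = 1) →
    ∃ (I : Type) (_ : Fintype I) (_ : DecidableEq I) (d m : I → Type) (_ : ∀ i, Fintype (d i))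
      (_ : ∀ i, DecidableEq (d i)) (_ : ∀ i, Fintype (m i)) (_ : ∀ i, DecidableEq (m i))
      (ϑ : ∀ i, G →* Matrix (d i) (d i) ℂ) (T : Matrix n (BlockIndex d m) ℂ),
      (∀ i g, (ϑ i g)ᴴ * ϑ i g = 1) ∧ IsSymmetryAdapted ρ ϑ m T Tᴴ

end Literature.Analysis.Convex.SymmetryAdapted
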